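import Mathlib.RingTheory.MvPolynomial.Homogeneous
import Mathlib.Algebra.Group.Pointwise.Finset.Basic
import Literature.Computability.AlgebraicComplexity.HomogeneousDepthFour
import Literature.Computability.AlgebraicComplexity.CircuitGateSemantics
import HarnessLib

/-!
# The normal form `∑_i ∏_j Q_{ij}` of a homogeneous `ΣΠΣΠ` circuit (Kumar–Saraf 2017, §3,
eq. (3.1)) in the tree's circuit model, and restrictions `P|_V`

Topic `Literature/Computability/AlgebraicComplexity`; second infrastructure file for the printed
proof of `kumarSaraf2017_imm_homDepthFour` (`HomogeneousDepthFour.lean`), circuit side.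

Kumar–Saraf, §3: "A homogeneous polynomial `P` of degree `n` … computed by a homogeneous `ΣΠΣΠ`
circuit can be written as `P = ∑_{i=1}^{T} ∏_{j=1}^{d_i} Q_{i,j}` (3.1). Here, `T` is the top
fan-in of the circuit. Since the circuit is homogeneous, `∑_j deg(Q_{i,j}) = n`", the `Q_{ij}`
being sums of the monomials computed by the bottom product gates. This file proves that normal
form for the tree's model — `ArithCircuit` with the layer discipline `ArithCircuit.IsDepthFour`
(`sigmaPiDepth ≤ 4`, layers `Π(1) Σ(2) Π(3) Σ(4)` from the bottom) and semantic homogeneity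
`ArithCircuit.IsHomogeneousCircuit` — in the shape the lower-bound argument uses:

* per-gate layer API (`gateLayer`, `opLayer`, `argMaxLayer`; prefix lemmas for the fold
  `gateLayers`, exactly parallel to `CircuitGateSemantics.lean` for `gateWDepths`);
* `monoExps P` — the exponent vectors of the gate values that are single monomials (this contains
  the monomial of every non-zero layer-1 = bottom product gate), `card_monoExps_le : ≤ P.size`
  ("the number of bottom product gates is at most the size");
* `IsBottomFactor P q` — every monomial of `q` is a bottom monomial (`∈ monoExps P`) or has degree
  `≤ 1` (a variable or a constant): the shape of the `Q_{ij}` (layer-`≤ 2` values);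
* layer lemmas: layer `≤ 1` values are monomials (`card_support_gateVal_le_one`), layer `≤ 2`
  values are bottom factors (`isBottomFactor_gateVal`), layer `≤ 3` values are products of
  homogeneous bottom factors (`exists_factors_gateVal`);
* **normal form** `exists_sum_prod`: if a homogeneous depth-4 circuit `P` computes `f`,
  homogeneous of degree `n ≥ 2`, then `f = ∑_{q ∈ Q} c_q · q` with `|Q| ≤ P.size`, every `q ≠ 0`
  homogeneous of degree `n` and a product of homogeneous bottom factors (the top sum gate's operands
  of degree `≠ n` cancel: take the degree-`n` homogeneous component; `T ≤ size` because distinct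
  non-junk gate operands are distinct gates);
* `restrictVars V` — the substitution `x_v ↦ 0` (`v ∉ V`), i.e. `P|_V` of [KS, §3]
  ("removing all monomials containing a variable not in `V`"): `coeff_restrictVars`,
  `mem_support_restrictVars`, `totalDegree_restrictVars_le`, `IsHomogeneous.restrictVars`.

Everything is proved from the definitions (D-0026: no named facts).

## References

* M. Kumar, S. Saraf, *On the power of homogeneous depth 4 arithmetic circuits*, SIAM J. Comput.
  46 (2017) 336–387 (arXiv:1404.1950): §3 (model, eq. (3.1), `ΣΠΣΠ^{{s}}` circuits, `C|_V`,
  `P|_V`).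
* P. Bürgisser, *Completeness and Reduction in Algebraic Complexity Theory*, Springer 2000,
  Def. 2.1 (the straight-line model of `ArithCircuit.lean`).
-/

noncomputable section

open MvPolynomial

namespace Literature.Computability.AlgebraicComplexity

universe u v

namespace ArithCircuit

variable {k : Type u} {σ : Type v}

/-! ### Per-gate layers (the fold `gateLayers`, gate by gate) -/

section LayerFolds

/-- The layer list of a prefix of the gate list is the prefix of the layer list.
[cite: KumarSaraf2017, §3] -/
theorem gateLayers_take_eq_take (gs : List (Gate k σ)) (i : ℕ) :
    gateLayers (gs.take i) = (gateLayers gs).take i := by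
  induction gs using List.reverseRecOn generalizing i with
  | nil => simp [gateLayers]
  | append_singleton gs g ih =>
    by_cases hi : i ≤ gs.length
    · rw [List.take_append_of_le_length hi, ih, gateLayers_append_singleton,
        List.take_append_of_le_length (by rwa [gateLayers_length])]
    · push Not at hi
      have h1 : (gs ++ [g]).take i = gs ++ [g] :=
        List.take_of_length_le (by simp; omega)
      have h2 : (gateLayers (gs ++ [g])).take i = gateLayers (gs ++ [g]) :=
        List.take_of_length_le (by rw [gateLayers_length]; simp; omega)
      rw [h1, h2]

/-- **Per-gate layer**: the layer of gate `i` is `layerStep` above the maximal layer of its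
operands, read against the layers of the gates before it. [cite: KumarSaraf2017, §3] -/
theorem gateLayers_getElem? (gs : List (Gate k σ)) (i : ℕ) (g : Gate k σ) (hg : gs[i]? = some g) :
    (gateLayers gs)[i]? =
      some (g.layerStep ((g.args.map (Operand.depthIn (gateLayers (gs.take i)))).foldr max 0)) := by
  have hi : i < gs.length := (List.getElem?_eq_some_iff.1 hg).1
  have h := gateLayers_take_eq_take gs (i + 1)
  rw [List.take_add_one, hg, Option.toList_some, gateLayers_append_singleton] at h
  have hlen : (gateLayers (gs.take i)).length = i := by
    rw [gateLayers_length, List.length_take, min_eq_left hi.le]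
  set x := g.layerStep ((g.args.map (Operand.depthIn (gateLayers (gs.take i)))).foldr max 0)
  have lhs : (gateLayers (gs.take i) ++ [x])[i]? = some x := by
    rw [List.getElem?_append_right (by omega), hlen, Nat.sub_self, List.getElem?_cons_zero]
  rw [h, List.getElem?_take, if_pos (Nat.lt_succ_self i)] at lhs
  exact lhs

/-- The layer of gate number `i` of `P` in the template `Π(1) Σ(2) Π(3) Σ(4) ⋯` (junk `0` out of
range). [cite: KumarSaraf2017, §3] -/
def gateLayer (P : ArithCircuit k σ) (i : ℕ) : ℕ := (gateLayers P.gates).getD i 0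

/-- The layer of an operand *as seen by gate `i`*: `0` for variables, constants and junk
references, the layer of gate `j` for a reference `gate j` with `j < i`. [cite: KumarSaraf2017, §3] -/
def opLayer (P : ArithCircuit k σ) (i : ℕ) : Operand k σ → ℕ
  | .var _ => 0
  | .const _ => 0
  | .gate j => if j < i then P.gateLayer j else 0

/-- Unfolding `opLayer` on a gate reference. [cite: KumarSaraf2017, §3] -/
@[simp] theorem opLayer_gate (P : ArithCircuit k σ) (i j : ℕ) :
    P.opLayer i (.gate j) = if j < i then P.gateLayer j else 0 := rfl

/-- Unfolding `opLayer` on a variable. [cite: KumarSaraf2017, §3] -/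
@[simp] theorem opLayer_var (P : ArithCircuit k σ) (i : ℕ) (v : σ) : P.opLayer i (.var v) = 0 := rfl

/-- Unfolding `opLayer` on a constant. [cite: KumarSaraf2017, §3] -/
@[simp] theorem opLayer_const (P : ArithCircuit k σ) (i : ℕ) (c : k) : P.opLayer i (.const c) = 0 :=
  rfl

/-- Reading an operand's layer against the first `i` gate layers is `opLayer P i`.
[cite: KumarSaraf2017, §3] -/
theorem depthIn_gateLayers_take (P : ArithCircuit k σ) (i : ℕ) (u : Operand k σ) :
    u.depthIn (gateLayers (P.gates.take i)) = P.opLayer i u := by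
  cases u with
  | var v => rfl
  | const c => rfl
  | gate j =>
    change (gateLayers (P.gates.take i)).getD j 0 = if j < i then P.gateLayer j else 0
    rw [gateLayers_take_eq_take, List.getD_eq_getElem?_getD, List.getElem?_take]
    split_ifs with h
    · rw [gateLayer, List.getD_eq_getElem?_getD]
    · rfl

/-- The maximal layer of the operands of a gate placed at position `i`. [cite: KumarSaraf2017, §3] -/
def argMaxLayer (P : ArithCircuit k σ) (i : ℕ) (g : Gate k σ) : ℕ :=
  ((g.args.map (P.opLayer i)).foldr max 0)

/-- **The layer of gate `i` is `layerStep` above the maximal layer of its operands.**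
[cite: KumarSaraf2017, §3] -/
theorem gateLayer_eq (P : ArithCircuit k σ) {i : ℕ} {g : Gate k σ} (hg : P.gates[i]? = some g) :
    P.gateLayer i = g.layerStep (P.argMaxLayer i g) := by
  unfold gateLayer argMaxLayer
  rw [List.getD_eq_getElem?_getD, gateLayers_getElem? P.gates i g hg, Option.getD_some]
  congr 2
  exact List.map_congr_left fun u _ => depthIn_gateLayers_take P i u

/-- Each operand of a gate lies in a layer at most the maximal operand layer.
[cite: KumarSaraf2017, §3] -/
theorem opLayer_le_argMaxLayer (P : ArithCircuit k σ) (i : ℕ) {g : Gate k σ} {u : Operand k σ}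
    (hu : u ∈ g.args) : P.opLayer i u ≤ P.argMaxLayer i g :=
  le_foldr_max_of_mem (List.mem_map.2 ⟨u, hu, rfl⟩)

/-- The maximal operand layer lies strictly below the gate. [cite: KumarSaraf2017, §3] -/
theorem argMaxLayer_lt_gateLayer (P : ArithCircuit k σ) {i : ℕ} {g : Gate k σ}
    (hg : P.gates[i]? = some g) : P.argMaxLayer i g < P.gateLayer i := by
  rw [P.gateLayer_eq hg]
  exact lt_layerStep g _

/-- Each operand of gate `i` lies strictly below gate `i`. [cite: KumarSaraf2017, §3] -/
theorem opLayer_lt_gateLayer (P : ArithCircuit k σ) {i : ℕ} {g : Gate k σ}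
    (hg : P.gates[i]? = some g) {u : Operand k σ} (hu : u ∈ g.args) :
    P.opLayer i u < P.gateLayer i :=
  (P.opLayer_le_argMaxLayer i hu).trans_lt (P.argMaxLayer_lt_gateLayer hg)

/-- Product gates sit in odd layers. [cite: KumarSaraf2017, §3] -/
theorem gateLayer_mod_two_of_prod (P : ArithCircuit k σ) {i : ℕ} {args : List (Operand k σ)}
    (hg : P.gates[i]? = some (.prod args)) : P.gateLayer i % 2 = 1 := by
  rw [P.gateLayer_eq hg]
  simp only [Gate.layerStep]
  split_ifs with h <;> omega

/-- Sum gates sit in even layers. [cite: KumarSaraf2017, §3] -/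
theorem gateLayer_mod_two_of_sum (P : ArithCircuit k σ) {i : ℕ} {args : List (k × Operand k σ)}
    (hg : P.gates[i]? = some (.sum args)) : P.gateLayer i % 2 = 0 := by
  rw [P.gateLayer_eq hg]
  simp only [Gate.layerStep]
  split_ifs with h <;> omega

/-- Real gates sit in layers `≥ 1`. [cite: KumarSaraf2017, §3] -/
theorem one_le_gateLayer (P : ArithCircuit k σ) {i : ℕ} (hi : i < P.size) : 1 ≤ P.gateLayer i := by
  obtain ⟨g, hg⟩ : ∃ g, P.gates[i]? = some g := ⟨P.gates[i], List.getElem?_eq_getElem hi⟩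
  have := P.argMaxLayer_lt_gateLayer hg
  omega

/-- The `ΣΠ`-depth of `P` is the layer of its output operand as seen after all gates.
[cite: KumarSaraf2017, §3] -/
theorem sigmaPiDepth_eq_opLayer_output (P : ArithCircuit k σ) :
    P.sigmaPiDepth = P.opLayer P.size P.output := by
  rw [sigmaPiDepth, ← depthIn_gateLayers_take, size, List.take_length]

end LayerFolds

/-! ### Bottom monomials, bottom factors, and the values of the low layers -/

section Values

variable [CommSemiring k]

/-- A gate value in range is an entry of the value list. [cite: Burgisser2000, Def. 2.1] -/
theorem gateVal_mem_gateValues (P : ArithCircuit k σ) {i : ℕ} (hi : i < P.size) :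
    P.gateVal i ∈ gateValues P.gates := by
  unfold gateVal
  rw [List.getD_eq_getElem?_getD,
    List.getElem?_eq_getElem (show i < (gateValues P.gates).length by rwa [gateValues_length]),
    Option.getD_some]
  exact List.getElem_mem _

/-- Every gate value of a homogeneous circuit is homogeneous. [cite: KumarSaraf2017, §3] -/
theorem IsHomogeneousCircuit.gateVal {P : ArithCircuit k σ} (hh : P.IsHomogeneousCircuit)
    (i : ℕ) : ∃ e, (P.gateVal i).IsHomogeneous e := by
  by_cases hi : i < P.size
  · exact hh _ (P.gateVal_mem_gateValues hi)
  · rw [P.gateVal_of_le (not_lt.1 hi)]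
    exact ⟨0, isHomogeneous_zero σ k 0⟩

/-- Every operand value of a homogeneous circuit is homogeneous. [cite: KumarSaraf2017, §3] -/
theorem IsHomogeneousCircuit.opVal {P : ArithCircuit k σ} (hh : P.IsHomogeneousCircuit)
    (i : ℕ) (u : Operand k σ) : ∃ e, (P.opVal i u).IsHomogeneous e := by
  cases u with
  | var v => exact ⟨1, isHomogeneous_X k v⟩
  | const c => exact ⟨0, isHomogeneous_C σ c⟩
  | gate j =>
    rw [opVal_gate]
    split_ifs
    · exact hh.gateVal j
    · exact ⟨0, isHomogeneous_zero σ k 0⟩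

variable [DecidableEq σ]

/-- **The bottom monomials of a circuit**: the exponent vectors of those gate values which are a
single monomial. Every non-zero value of a layer-1 gate (a bottom product gate: a product of
leaves) is such a monomial, so this finite set contains the monomials "computed by the product
gates at the bottom level" of Kumar–Saraf, §3, and it has at most `size` elements
(`card_monoExps_le`). [cite: KumarSaraf2017, §3] -/
def monoExps (P : ArithCircuit k σ) : Finset (σ →₀ ℕ) :=
  (Finset.range P.size).biUnion fun j =>
    if (P.gateVal j).support.card = 1 then (P.gateVal j).support else ∅

/-- **"The number of bottom product gates is at most the size of the circuit."**
[cite: KumarSaraf2017, §3 and Lemma 8.2] -/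
theorem card_monoExps_le (P : ArithCircuit k σ) : P.monoExps.card ≤ P.size := by
  unfold monoExps
  refine (Finset.card_biUnion_le).trans ?_
  calc ∑ j ∈ Finset.range P.size,
        (if (P.gateVal j).support.card = 1 then (P.gateVal j).support else ∅).card
      ≤ ∑ _j ∈ Finset.range P.size, 1 := Finset.sum_le_sum fun j _ => by
        split_ifs with h
        · exact h.le
        · simp
    _ = P.size := by simp

/-- A monomial gate value contributes its exponent vector to `monoExps`. [cite: KumarSaraf2017, §3] -/
theorem mem_monoExps_of_card_le_one (P : ArithCircuit k σ) {j : ℕ} (hj : j < P.size)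
    (hcard : (P.gateVal j).support.card ≤ 1) {β : σ →₀ ℕ} (hβ : β ∈ (P.gateVal j).support) :
    β ∈ P.monoExps := by
  unfold monoExps
  rw [Finset.mem_biUnion]
  refine ⟨j, Finset.mem_range.2 hj, ?_⟩
  have h1 : (P.gateVal j).support.card = 1 :=
    le_antisymm hcard (Finset.card_pos.2 ⟨β, hβ⟩)
  rw [if_pos h1]
  exact hβ

/-- **Bottom factors**: every monomial of `q` is a bottom monomial of `P` or has degree `≤ 1`
(a variable or a constant) — the shape of the `Q_{ij}` of eq. (3.1), sums of the monomials of
bottom product gates and of leaves. [cite: KumarSaraf2017, §3] -/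
def IsBottomFactor (P : ArithCircuit k σ) (q : MvPolynomial σ k) : Prop :=
  ∀ β ∈ q.support, β ∈ P.monoExps ∨ β.degree ≤ 1

namespace IsBottomFactor

variable {P : ArithCircuit k σ}

/-- `0` is a bottom factor. [cite: KumarSaraf2017, §3] -/
theorem zero : P.IsBottomFactor 0 := fun β hβ => by simp at hβ

/-- Variables are bottom factors. [cite: KumarSaraf2017, §3] -/
theorem X (v : σ) : P.IsBottomFactor (MvPolynomial.X v) := by
  intro β hβ
  right
  have h := support_monomial_subset (Finset.mem_of_subset (by rfl) (X_pow_eq_monomial (R := k)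
    (n := v) (e := 1) ▸ pow_one (MvPolynomial.X (R := k) v) ▸ hβ))
  rw [Finset.mem_singleton] at h
  rw [h, Finsupp.degree_single]

/-- Constants are bottom factors. [cite: KumarSaraf2017, §3] -/
theorem C (c : k) : P.IsBottomFactor (MvPolynomial.C c) := by
  intro β hβ
  right
  have h := support_monomial_subset (C_apply (R := k) (a := c) (σ := σ) ▸ hβ)
  rw [Finset.mem_singleton] at h
  rw [h, map_zero]
  exact Nat.zero_le _

/-- Sums of bottom factors. [cite: KumarSaraf2017, §3] -/
theorem add {p q : MvPolynomial σ k} (hp : P.IsBottomFactor p) (hq : P.IsBottomFactor q) :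
    P.IsBottomFactor (p + q) := by
  intro β hβ
  rcases Finset.mem_union.1 (support_add hβ) with h | h
  · exact hp β h
  · exact hq β h

/-- Scalar multiples of bottom factors. [cite: KumarSaraf2017, §3] -/
theorem smul (c : k) {q : MvPolynomial σ k} (hq : P.IsBottomFactor q) : P.IsBottomFactor (c • q) :=
  fun β hβ => hq β (support_smul hβ)

/-- Weighted sums of bottom factors (the value of a sum gate over bottom factors).
[cite: KumarSaraf2017, §3] -/
theorem list_sum_smul {α : Type*} (l : List α) (c : α → k) (f : α → MvPolynomial σ k)
    (h : ∀ a ∈ l, P.IsBottomFactor (f a)) :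
    P.IsBottomFactor (l.map fun a => c a • f a).sum := by
  induction l with
  | nil => simpa using (zero : P.IsBottomFactor 0)
  | cons a l ih =>
    rw [List.map_cons, List.sum_cons]
    exact (smul _ (h a (by simp))).add (ih fun b hb => h b (by simp [hb]))

/-- A polynomial with at most one monomial, computed by a gate in range, is a bottom factor.
[cite: KumarSaraf2017, §3] -/
theorem of_card_le_one {j : ℕ} (hj : j < P.size) (hcard : (P.gateVal j).support.card ≤ 1) :
    P.IsBottomFactor (P.gateVal j) :=
  fun _ hβ => Or.inl (P.mem_monoExps_of_card_le_one hj hcard hβ)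

end IsBottomFactor

/-- The support of a product of polynomials with at most one monomial each has at most one
monomial. [folklore] -/
theorem card_support_list_prod_le_one (L : List (MvPolynomial σ k))
    (h : ∀ q ∈ L, q.support.card ≤ 1) : L.prod.support.card ≤ 1 := by
  induction L with
  | nil =>
    rw [List.prod_nil]
    exact (Finset.card_le_card (support_monomial_subset (s := 0) (a := (1 : k)))).trans
      (Finset.card_singleton _).le
  | cons q L ih =>
    rw [List.prod_cons]
    have hq := h q (by simp)
    have hL := ih fun p hp => h p (by simp [hp])
    open Pointwise in
    calc (q * L.prod).support.card ≤ (q.support + L.prod.support).card :=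
          Finset.card_le_card (support_mul q L.prod)
      _ ≤ q.support.card * L.prod.support.card := Finset.card_add_le
      _ ≤ 1 * 1 := Nat.mul_le_mul hq hL
      _ = 1 := rfl

omit [DecidableEq σ] in
/-- Operands of layer `0` (leaves and junk references) have at most one monomial.
[cite: KumarSaraf2017, §3] -/
theorem card_support_opVal_le_one (P : ArithCircuit k σ) {i : ℕ} (hi : i ≤ P.size)
    {u : Operand k σ} (hu : P.opLayer i u = 0) : (P.opVal i u).support.card ≤ 1 := by
  cases u with
  | var v =>
    rw [opVal_var]
    calc (MvPolynomial.X v : MvPolynomial σ k).support.card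
        ≤ ({Finsupp.single v 1} : Finset (σ →₀ ℕ)).card := by
          refine Finset.card_le_card ?_
          rw [X_pow_eq_monomial.symm.trans (pow_one _) |>.symm]
          exact support_monomial_subset
      _ = 1 := Finset.card_singleton _
  | const c =>
    rw [opVal_const, C_apply]
    exact (Finset.card_le_card support_monomial_subset).trans (Finset.card_singleton _).le
  | gate j =>
    rw [opVal_gate]
    split_ifs with hj
    · rw [opLayer_gate, if_pos hj] at hu
      have := P.one_le_gateLayer (lt_of_lt_of_le hj hi)
      omega
    · simp

/-- **Layer `≤ 1`: bottom product gates compute monomials** — a gate of layer `≤ 1` is a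
product of leaves, so its value has at most one monomial. [cite: KumarSaraf2017, §3] -/
theorem card_support_gateVal_le_one (P : ArithCircuit k σ) {i : ℕ} (h1 : P.gateLayer i ≤ 1) :
    (P.gateVal i).support.card ≤ 1 := by
  by_cases hi : i < P.size
  · obtain ⟨g, hg⟩ : ∃ g, P.gates[i]? = some g := ⟨P.gates[i], List.getElem?_eq_getElem hi⟩
    cases g with
    | sum args =>
      have h2 := P.gateLayer_mod_two_of_sum hg
      have h3 := P.one_le_gateLayer hi
      omega
    | prod args =>
      rw [P.gateVal_of_prod hg]
      refine card_support_list_prod_le_one _ fun q hq => ?_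
      obtain ⟨u, hu, rfl⟩ := List.mem_map.1 hq
      refine P.card_support_opVal_le_one hi.le ?_
      have := P.opLayer_lt_gateLayer hg (u := u) hu
      omega
  · rw [P.gateVal_of_le (not_lt.1 hi)]
    simp

/-- Operands of layer `≤ 1` evaluate to bottom factors. [cite: KumarSaraf2017, §3] -/
theorem isBottomFactor_opVal (P : ArithCircuit k σ) {i : ℕ} (hi : i ≤ P.size)
    {u : Operand k σ} (hu : P.opLayer i u ≤ 1) : P.IsBottomFactor (P.opVal i u) := by
  cases u with
  | var v => exact IsBottomFactor.X v
  | const c => exact IsBottomFactor.C c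
  | gate j =>
    rw [opVal_gate]
    split_ifs with hj
    · rw [opLayer_gate, if_pos hj] at hu
      exact IsBottomFactor.of_card_le_one (lt_of_lt_of_le hj hi)
        (P.card_support_gateVal_le_one hu)
    · exact IsBottomFactor.zero

/-- **Layer `≤ 2`: the `Q_{ij}` are sums of bottom monomials and leaves** — the value of a gate
of layer `≤ 2` is a bottom factor. [cite: KumarSaraf2017, §3] -/
theorem isBottomFactor_gateVal (P : ArithCircuit k σ) {i : ℕ} (h2 : P.gateLayer i ≤ 2) :
    P.IsBottomFactor (P.gateVal i) := by
  by_cases hi : i < P.size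
  · obtain ⟨g, hg⟩ : ∃ g, P.gates[i]? = some g := ⟨P.gates[i], List.getElem?_eq_getElem hi⟩
    cases g with
    | prod args =>
      have hodd := P.gateLayer_mod_two_of_prod hg
      exact IsBottomFactor.of_card_le_one hi (P.card_support_gateVal_le_one (by omega))
    | sum args =>
      rw [P.gateVal_of_sum hg]
      refine IsBottomFactor.list_sum_smul args Prod.fst (fun a => P.opVal i a.2) fun a ha => ?_
      refine P.isBottomFactor_opVal hi.le ?_
      have := P.opLayer_lt_gateLayer hg (u := a.2) (List.mem_map.2 ⟨a, ha, rfl⟩)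
      omega
  · rw [P.gateVal_of_le (not_lt.1 hi)]
    exact IsBottomFactor.zero

/-- Operands of layer `≤ 2` of a homogeneous circuit evaluate to homogeneous bottom factors.
[cite: KumarSaraf2017, §3] -/
theorem isBottomFactor_opVal_of_le_two {P : ArithCircuit k σ} (hh : P.IsHomogeneousCircuit)
    {i : ℕ} {u : Operand k σ} (hu : P.opLayer i u ≤ 2) :
    P.IsBottomFactor (P.opVal i u) ∧ ∃ e, (P.opVal i u).IsHomogeneous e := by
  refine ⟨?_, hh.opVal i u⟩
  cases u with
  | var v => exact IsBottomFactor.X v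
  | const c => exact IsBottomFactor.C c
  | gate j =>
    rw [opVal_gate]
    split_ifs with hj
    · rw [opLayer_gate, if_pos hj] at hu
      exact P.isBottomFactor_gateVal hu
    · exact IsBottomFactor.zero

/-- **Layer `≤ 3`: the products `∏_j Q_{ij}`** — the value of a gate of layer `≤ 3` of a
homogeneous circuit is the product of a list of homogeneous bottom factors (for a product gate:
the values of its operands, all of layer `≤ 2`; for a sum gate, of layer `≤ 2`: itself).
[cite: KumarSaraf2017, §3] -/
theorem exists_factors_gateVal {P : ArithCircuit k σ} (hh : P.IsHomogeneousCircuit) {i : ℕ}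
    (hi : i < P.size) (h3 : P.gateLayer i ≤ 3) :
    ∃ L : List (MvPolynomial σ k),
      (∀ q ∈ L, P.IsBottomFactor q ∧ ∃ e, q.IsHomogeneous e) ∧ P.gateVal i = L.prod := by
  obtain ⟨g, hg⟩ : ∃ g, P.gates[i]? = some g := ⟨P.gates[i], List.getElem?_eq_getElem hi⟩
  cases g with
  | prod args =>
    refine ⟨args.map (P.opVal i), fun q hq => ?_, P.gateVal_of_prod hg⟩
    obtain ⟨u, hu, rfl⟩ := List.mem_map.1 hq
    refine isBottomFactor_opVal_of_le_two hh ?_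
    have := P.opLayer_lt_gateLayer hg (u := u) hu
    omega
  | sum args =>
    have heven := P.gateLayer_mod_two_of_sum hg
    refine ⟨[P.gateVal i], fun q hq => ?_, by simp⟩
    rw [List.mem_singleton] at hq
    subst hq
    exact ⟨P.isBottomFactor_gateVal (by omega), hh.gateVal i⟩

end Values

/-! ### The normal form (3.1) -/

section NormalForm

variable [CommRing k] [DecidableEq σ]

/-- **Kumar–Saraf 2017, §3, eq. (3.1), in the tree's model.** If a homogeneous depth-4 circuit
`P` computes `f`, homogeneous of degree `n ≥ 2`, then
`f = ∑_{q ∈ Q} c_q · q` with `|Q| ≤ size(P)` ("`T` is the top fan-in"), where every `q ∈ Q` is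
non-zero, homogeneous of degree `n` ("since the circuit is homogeneous, `∑_j deg(Q_{ij}) = n`")
and the product of a list of homogeneous bottom factors `Q_{ij}` (`IsBottomFactor`: sums of
bottom monomials and leaves). Proof: the output is a leaf (impossible or `f = 0`), a gate of layer
`≤ 3` (one product, `exists_factors_gateVal`), or a top sum gate of layer `4`, whose value is a
weighted sum of operand values of layer `≤ 3`; taking the degree-`n` homogeneous component keeps
exactly the operands that are gates of layer `≤ 3` with non-zero value of degree `n` (leaves have
degree `≤ 1 < n`), and distinct such operands are distinct gates, at most `size` of them.
[cite: KumarSaraf2017, §3 eq. (3.1)] -/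
theorem exists_sum_prod {P : ArithCircuit k σ} {f : MvPolynomial σ k} (hc : P.Computes f)
    (h4 : P.IsDepthFour) (hh : P.IsHomogeneousCircuit) {n : ℕ} (hf : f.IsHomogeneous n)
    (hn : 2 ≤ n) :
    ∃ (Q : Finset (MvPolynomial σ k)) (c : MvPolynomial σ k → k),
      Q.card ≤ P.size ∧ f = ∑ q ∈ Q, c q • q ∧
      ∀ q ∈ Q, q ≠ 0 ∧ q.IsHomogeneous n ∧
        ∃ L : List (MvPolynomial σ k),
          (∀ g ∈ L, P.IsBottomFactor g ∧ ∃ e, g.IsHomogeneous e) ∧ q = L.prod := by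
  classical
  -- the trivial normal form of `f = 0`
  have triv : f = 0 → ∃ (Q : Finset (MvPolynomial σ k)) (c : MvPolynomial σ k → k),
      Q.card ≤ P.size ∧ f = ∑ q ∈ Q, c q • q ∧
      ∀ q ∈ Q, q ≠ 0 ∧ q.IsHomogeneous n ∧
        ∃ L : List (MvPolynomial σ k),
          (∀ g ∈ L, P.IsBottomFactor g ∧ ∃ e, g.IsHomogeneous e) ∧ q = L.prod := by
    intro h0
    exact ⟨∅, fun _ => 0, by simp, by simp [h0], by simp⟩
  have hf' : f = P.opVal P.size P.output := by rw [← eval_eq_opVal_output]; exact hc.symm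
  have hL4 : P.opLayer P.size P.output ≤ 4 := by
    rw [← sigmaPiDepth_eq_opLayer_output]; exact h4
  -- case analysis on the output operand
  rcases hout : P.output with v | c₀ | j₀
  · -- a variable: degree `1 ≠ n`, so `f = X v = 0` (trivial ring) or contradiction
    rw [hout, opVal_var] at hf'
    by_cases hX : (MvPolynomial.X v : MvPolynomial σ k) = 0
    · exact triv (hf'.trans hX)
    · have h1 : (MvPolynomial.X v : MvPolynomial σ k).IsHomogeneous 1 := isHomogeneous_X k v
      have := h1.inj_right (hf' ▸ hf) hX
      omega
  · -- a constant: degree `0 ≠ n`, so `f = C c₀ = 0`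
    rw [hout, opVal_const] at hf'
    by_cases hC : (MvPolynomial.C c₀ : MvPolynomial σ k) = 0
    · exact triv (hf'.trans hC)
    · have h0 : (MvPolynomial.C c₀ : MvPolynomial σ k).IsHomogeneous 0 := isHomogeneous_C σ c₀
      have := h0.inj_right (hf' ▸ hf) hC
      omega
  · rw [hout, opVal_gate] at hf'
    rw [hout, opLayer_gate] at hL4
    by_cases hj₀ : j₀ < P.size
    · rw [if_pos hj₀] at hf' hL4
      by_cases h3 : P.gateLayer j₀ ≤ 3
      · -- a single product
        by_cases hz : P.gateVal j₀ = 0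
        · exact triv (hf'.trans hz)
        · obtain ⟨L, hL, hprod⟩ := exists_factors_gateVal hh hj₀ h3
          refine ⟨{P.gateVal j₀}, fun _ => 1, ?_, ?_, ?_⟩
          · rw [Finset.card_singleton]; omega
          · rw [Finset.sum_singleton, one_smul]; exact hf'
          · intro q hq
            rw [Finset.mem_singleton] at hq
            subst hq
            exact ⟨hz, hf' ▸ hf, L, hL, hprod⟩
      · -- the top sum gate, layer `4`
        have h4' : P.gateLayer j₀ = 4 := by omega
        obtain ⟨g, hg⟩ : ∃ g, P.gates[j₀]? = some g := ⟨P.gates[j₀], List.getElem?_eq_getElem hj₀⟩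
        cases g with
        | prod args =>
          have := P.gateLayer_mod_two_of_prod hg
          omega
        | sum args =>
          -- the operands are of layer `≤ 3`
          have hargs : ∀ a ∈ args, P.opLayer j₀ a.2 ≤ 3 := fun a ha => by
            have := P.opLayer_lt_gateLayer hg (u := a.2) (List.mem_map.2 ⟨a, ha, rfl⟩)
            omega
          -- the good gates among the operands
          set J : Finset ℕ := (Finset.range j₀).filter fun j =>
            P.gateLayer j ≤ 3 ∧ P.gateVal j ≠ 0 ∧ (P.gateVal j).IsHomogeneous n with hJ
          set Q : Finset (MvPolynomial σ k) := J.image P.gateVal with hQ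
          -- `f` lies in the span of the good gate values
          have hspan : f ∈ Submodule.span k (Q : Set (MvPolynomial σ k)) := by
            have hcomp : f = homogeneousComponent n f := by
              rw [homogeneousComponent_of_mem hf, if_pos rfl]
            rw [hcomp, hf', P.gateVal_of_sum hg, map_list_sum, List.map_map]
            refine list_sum_mem fun x hx => ?_
            obtain ⟨a, ha, rfl⟩ := List.mem_map.1 hx
            simp only [Function.comp_apply, map_smul]
            refine Submodule.smul_mem _ _ ?_
            -- the degree-`n` component of an operand value of layer `≤ 3`
            rcases hu : a.2 with v | c₁ | j
            · rw [opVal_var, homogeneousComponent_of_mem (isHomogeneous_X k v), if_neg (by omega)]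
              exact Submodule.zero_mem _
            · rw [opVal_const, homogeneousComponent_of_mem (isHomogeneous_C σ c₁),
                if_neg (by omega)]
              exact Submodule.zero_mem _
            · rw [opVal_gate]
              split_ifs with hj
              · obtain ⟨e, he⟩ := hh.gateVal j
                rw [homogeneousComponent_of_mem he]
                split_ifs with hen
                · subst hen
                  by_cases hz : P.gateVal j = 0
                  · rw [hz]; exact Submodule.zero_mem _
                  · refine Submodule.subset_span (Finset.mem_coe.2 ?_)
                    rw [hQ, Finset.mem_image]
                    refine ⟨j, ?_, rfl⟩
                    rw [hJ, Finset.mem_filter, Finset.mem_range]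
                    have hl : P.opLayer j₀ a.2 ≤ 3 := hargs a ha
                    rw [hu, opLayer_gate, if_pos hj] at hl
                    exact ⟨hj, hl, hz, he⟩
                · exact Submodule.zero_mem _
              · rw [map_zero]; exact Submodule.zero_mem _
          obtain ⟨c, -, hsum⟩ := Submodule.mem_span_finset.1 hspan
          refine ⟨Q, c, ?_, hsum.symm, ?_⟩
          · calc Q.card ≤ J.card := Finset.card_image_le
              _ ≤ (Finset.range j₀).card := Finset.card_filter_le _ _
              _ ≤ P.size := by rw [Finset.card_range]; exact hj₀.le
          · intro q hq
            rw [hQ, Finset.mem_image] at hq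
            obtain ⟨j, hj, rfl⟩ := hq
            rw [hJ, Finset.mem_filter, Finset.mem_range] at hj
            obtain ⟨hjlt, hl3, hz, hhom⟩ := hj
            exact ⟨hz, hhom, exists_factors_gateVal hh (hjlt.trans hj₀) hl3⟩
    · rw [if_neg hj₀] at hf'
      exact triv hf'

end NormalForm

end ArithCircuit

/-! ### Restrictions `P|_V`: setting the variables outside `V` to zero -/

section Restrict

variable {k : Type u} [CommSemiring k] {σ : Type v} [DecidableEq σ]

/-- **The restriction `P|_V`** (Kumar–Saraf 2017, §3): "the polynomial obtained after setting
variables not in `V` to zero (i.e. removing all monomials containing a variable not in `V` in its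
support)", as a `k`-algebra endomorphism. [cite: KumarSaraf2017, §3] -/
def restrictVars (V : Finset σ) : MvPolynomial σ k →ₐ[k] MvPolynomial σ k :=
  aeval fun v => if v ∈ V then X v else 0

/-- Restriction of a monomial: kept if all its variables lie in `V`, killed otherwise.
[cite: KumarSaraf2017, §3] -/
theorem restrictVars_monomial (V : Finset σ) (β : σ →₀ ℕ) (c : k) :
    restrictVars V (monomial β c) = if β.support ⊆ V then monomial β c else 0 := by
  unfold restrictVars
  rw [aeval_monomial, algebraMap_eq]
  split_ifs with h
  · rw [monomial_eq]
    congr 1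
    refine Finsupp.prod_congr fun v hv => ?_
    rw [if_pos (h hv)]
  · obtain ⟨v, hv, hvV⟩ := Finset.not_subset.1 h
    rw [Finsupp.prod, Finset.prod_eq_zero hv, mul_zero]
    rw [if_neg hvV, zero_pow (Finsupp.mem_support_iff.1 hv)]

/-- **Coefficients of the restriction**: the monomials with all variables in `V` keep their
coefficient, the others are removed. [cite: KumarSaraf2017, §3] -/
theorem coeff_restrictVars (V : Finset σ) (f : MvPolynomial σ k) (β : σ →₀ ℕ) :
    coeff β (restrictVars V f) = if β.support ⊆ V then coeff β f else 0 := by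
  classical
  conv_lhs => rw [f.as_sum, map_sum, coeff_sum]
  simp only [restrictVars_monomial]
  have key : ∀ γ ∈ f.support, coeff β (if γ.support ⊆ V then monomial γ (coeff γ f) else 0) =
      if γ = β then (if β.support ⊆ V then coeff β f else 0) else 0 := by
    intro γ _
    by_cases hγβ : γ = β
    · subst hγβ
      rw [if_pos rfl]
      split_ifs
      · rw [coeff_monomial, if_pos rfl]
      · rw [coeff_zero]
    · rw [if_neg hγβ]
      split_ifs
      · rw [coeff_monomial, if_neg hγβ]
      · rw [coeff_zero]
  rw [Finset.sum_congr rfl key, Finset.sum_ite_eq']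
  by_cases h1 : β ∈ f.support
  · rw [if_pos h1]
  · rw [if_neg h1, notMem_support_iff.1 h1]
    split_ifs <;> rfl

/-- The support of the restriction: the monomials of `f` with all variables in `V`.
[cite: KumarSaraf2017, §3] -/
theorem mem_support_restrictVars {V : Finset σ} {f : MvPolynomial σ k} {β : σ →₀ ℕ} :
    β ∈ (restrictVars V f).support ↔ β ∈ f.support ∧ β.support ⊆ V := by
  rw [mem_support_iff, mem_support_iff, coeff_restrictVars]
  split_ifs with h <;> simp [h]

/-- The support of the restriction is contained in the support. [cite: KumarSaraf2017, §3] -/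
theorem support_restrictVars_subset (V : Finset σ) (f : MvPolynomial σ k) :
    (restrictVars V f).support ⊆ f.support :=
  fun _ hβ => (mem_support_restrictVars.1 hβ).1

/-- Restriction does not increase the total degree. [cite: KumarSaraf2017, §3] -/
theorem totalDegree_restrictVars_le (V : Finset σ) (f : MvPolynomial σ k) :
    (restrictVars V f).totalDegree ≤ f.totalDegree :=
  Finset.sup_mono (support_restrictVars_subset V f)

/-- The restriction of a homogeneous polynomial is homogeneous of the same degree.
[cite: KumarSaraf2017, §3] -/
theorem _root_.MvPolynomial.IsHomogeneous.restrictVars {f : MvPolynomial σ k} {n : ℕ}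
    (hf : f.IsHomogeneous n) (V : Finset σ) : (restrictVars V f).IsHomogeneous n := by
  intro β hβ
  rw [coeff_restrictVars] at hβ
  split_ifs at hβ with h
  · exact hf hβ
  · exact absurd rfl hβ

end Restrict

end Literature.Computability.AlgebraicComplexity

end
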